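import Summits.NavierStokesRegularity.NavierStokesRegularity.Theses.TypeICertificateLadder
import Summits.NavierStokesRegularity.NavierStokesRegularity.Theses.SymmetryModuliCount
import Summits.NavierStokesRegularity.NavierStokesRegularity.Theorems.TypeICertificateLadderTargetRateClassLiouville
import Summits.NavierStokesRegularity.NavierStokesRegularity.Theorems.SymmetryModuliCountForcedSymmetryCollapse
import Summits.NavierStokesRegularity.NavierStokesRegularity.Theorems.SymmetryModuliCountHelicalEndLiouville
import Summits.NavierStokesRegularity.NavierStokesRegularity.Theorems.SymmetryModuliCountAxisymEndLiouville
import Literature.Analysis.FluidPDE.TypeIAncientMild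
import HarnessLib

/-!
# Crux `NoTypeIBlowup` (stmt-NavierStokesRegularity-1217) FOLLOWS FROM the crux `ForcedSymmetry`
# (stmt-NavierStokesRegularity-4052) of route `SymmetryModuliCount` — modulo PROVED items only

Lead prover `prover-line-stmt-NavierStokesRegularity-1217-1` (gen 1), 2026-08-16. A cross-route bridge
assembled entirely from landed tree theorems:

* `noTypeIBlowup_of_rateClassLiouville` (this crux's line `head-flux-channel`, p94280): Type-I Liouville in
  the Oseen-gauge rate class `IsTypeIAncientMild C` (all `C > 0`) ⟹ `NoTypeIBlowup`;
* `isTypeIAncientMild_iff` (Literature): the rate class is literally the inline class of route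
  `SymmetryModuliCount`, so its target `TypeIAncientLiouville` (stmt-4050) IS rate-class Liouville;
* `typeIAncientLiouville_of_forcedSymmetry_of_killingLeaves` (route `SymmetryModuliCount`, time-anchor
  collapse): `HelicalEndLiouville → AxisymEndLiouville → ForcedSymmetry → TypeIAncientLiouville`, whose two
  Killing-leaf hypotheses are now PROVED items — `symmetryModuliCount_helicalEndLiouville_proof`
  (stmt-14062) and `AxisymEndLiouville_of` (stmt-14061).

Hence `noTypeIBlowup_of_typeIAncientLiouville : TypeIAncientLiouville → NoTypeIBlowup` and
`noTypeIBlowup_of_forcedSymmetry : ForcedSymmetry → NoTypeIBlowup`: the crux of routes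
`TypeICertificateLadder` / `ThreadingFlux` / `CoreLogGas` is DOWNSTREAM of the single open crux
`ForcedSymmetry` (every Type-I ancient mild field in the KNSS gauge admits a non-zero infinitesimal
similarity symmetry). CONDITIONAL (the hypothesis is an open item); it does not close stmt-1217. No
definitions. Lands `--supports stmt-NavierStokesRegularity-1217`.
-/

noncomputable section

namespace Summit.NavierStokesRegularity.NavierStokesRegularity.Theorems

open Literature.Analysis.FluidPDE

/-- **Target `X` of route `SymmetryModuliCount` ⟹ crux `NoTypeIBlowup`.** `TypeIAncientLiouville`
(stmt-NavierStokesRegularity-4050: every smooth divergence-free KNSS-mild ancient field with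
`‖u(t,x)‖ ≤ C/√(−t)` vanishes) is, through `isTypeIAncientMild_iff`, Type-I Liouville in the Oseen-gauge
rate class at every level `C`, and the landed reduction `noTypeIBlowup_of_rateClassLiouville` (Type-I
zoom at Leray points + ladder glue) turns that into no Type-I blow-up for classical Leray–Hopf solutions
from rapidly decaying data. CONDITIONAL on the open item. [folklore composition; KNSS2009 §6] -/
theorem noTypeIBlowup_of_typeIAncientLiouville :
    Summit.NavierStokesRegularity.NavierStokesRegularity.Theses.SymmetryModuliCount.TypeIAncientLiouville → Summit.NavierStokesRegularity.NavierStokesRegularity.Theses.TypeICertificateLadder.NoTypeIBlowup :=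
  fun hX => noTypeIBlowup_of_rateClassLiouville fun C _ u hu => hX C u (isTypeIAncientMild_iff.1 hu)

/-- **Crux `ForcedSymmetry` (stmt-NavierStokesRegularity-4052) ⟹ crux `NoTypeIBlowup`
(stmt-NavierStokesRegularity-1217).** If every element of the Type-I rate class `A_C` admits a non-zero
infinitesimal similarity symmetry `ξ = (a, σ, A)` (`L_ξ u = 0`), then no Type-I blow-up occurs for Clay
data: the time-anchor collapse `typeIAncientLiouville_of_forcedSymmetry_of_killingLeaves` of route
`SymmetryModuliCount`, fed with the PROVED Killing-leaf items `symmetryModuliCount_helicalEndLiouville_proof`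
(stmt-14062) and `AxisymEndLiouville_of` (stmt-14061), gives `TypeIAncientLiouville`, and
`noTypeIBlowup_of_typeIAncientLiouville` concludes the crux BY NAME. CONDITIONAL on `ForcedSymmetry`
only; does not close the item. [folklore composition; KNSS2009 §1, §6] -/
theorem noTypeIBlowup_of_forcedSymmetry :
    Summit.NavierStokesRegularity.NavierStokesRegularity.Theses.SymmetryModuliCount.ForcedSymmetry → Summit.NavierStokesRegularity.NavierStokesRegularity.Theses.TypeICertificateLadder.NoTypeIBlowup :=
  fun hF => noTypeIBlowup_of_typeIAncientLiouville
    (typeIAncientLiouville_of_forcedSymmetry_of_killingLeaves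
      symmetryModuliCount_helicalEndLiouville_proof AxisymEndLiouville_of hF)

end Summit.NavierStokesRegularity.NavierStokesRegularity.Theorems

end
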